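import Mathlib

/-!
# Tier7/Line2/GaloisTrace — the number-field facts behind `eigenPeriod_galois` (cut for the Galois.lean prover)

Pure Mathlib, no cell import: (B3) Dedekind independence of the embeddings `K →+* ℂ` in the form used,
(B2) the trace-dual pairs separate the embeddings, (B4) every ℚ-linear functional on `K` is `x ↦ Tr(c x)`,
(B7) a ℚ-linear map `K → ℂ` with rational values factors through a ℚ-linear functional, and the trace as a sum
over ring embeddings. Filed by t7-plan-2 (gen 1) as the sub-lemma cut of GALOIS-LEMMAS.md lemma 2. §8(d): NO.
-/

namespace Summit.Ventures.HodgeRepro2.Tier7.Line2.GaloisTrace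

open Algebra

variable {K : Type} [Field K] [NumberField K]

/-- the trace as a sum over the ring embeddings `K →+* ℂ` (Mathlib's `trace_eq_sum_embeddings` uses `K →ₐ[ℚ] ℂ`) -/
theorem trace_eq_sum_ringHom (x : K) :
    ((Algebra.trace ℚ K x : ℚ) : ℂ) = ∑ σ : K →+* ℂ, σ x := by
  rw [← eq_ratCast (algebraMap ℚ ℂ), trace_eq_sum_embeddings ℂ]
  exact (Fintype.sum_equiv RingHom.equivRatAlgHom _ _ (fun σ => rfl)).symm

/-- (B3) Dedekind: a ℂ-linear relation `∑_σ a_σ σ(x) = 0` holding for all `x` has all `a_σ = 0`. -/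
theorem eq_zero_of_sum_embeddings (a : (K →+* ℂ) → ℂ)
    (h : ∀ x : K, ∑ σ : K →+* ℂ, a σ * σ x = 0) : ∀ σ, a σ = 0 := by
  have hli : LinearIndependent ℂ (fun σ : K →+* ℂ => ((σ : K →* ℂ) : K → ℂ)) :=
    (linearIndependent_monoidHom K ℂ).comp (fun σ : K →+* ℂ => (σ : K →* ℂ))
      RingHom.coe_monoidHom_injective
  rw [Fintype.linearIndependent_iff] at hli
  apply hli a
  funext x
  simpa [Finset.sum_apply] using h x

/-- (B4) every ℚ-linear functional on `K` is `x ↦ Tr_{K/ℚ}(c x)` (nondegeneracy of the trace form). -/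
theorem exists_trace_dual (l : K →ₗ[ℚ] ℚ) : ∃ c : K, ∀ x, l x = Algebra.trace ℚ K (c * x) := by
  refine ⟨((traceForm ℚ K).toDual (traceForm_nondegenerate ℚ K)).symm l, fun x => ?_⟩
  have h := LinearMap.BilinForm.toDual_def (traceForm_nondegenerate ℚ K)
    (m := ((traceForm ℚ K).toDual (traceForm_nondegenerate ℚ K)).symm l) (n := x)
  rw [LinearEquiv.apply_symm_apply] at h
  rw [h, traceForm_apply]

/-- (B7) a ℚ-linear map `K → ℂ` with rational values is `algebraMap ℚ ℂ ∘ l` for a ℚ-linear functional `l`. -/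
theorem exists_linear_of_rat (φ : K →ₗ[ℚ] ℂ) (h : ∀ x, ∃ q : ℚ, φ x = (q : ℂ)) :
    ∃ l : K →ₗ[ℚ] ℚ, ∀ x, φ x = algebraMap ℚ ℂ (l x) := by
  classical
  choose q hq using h
  have hinj : Function.Injective (fun r : ℚ => (r : ℂ)) := Rat.cast_injective
  refine ⟨{ toFun := q, map_add' := ?_, map_smul' := ?_ }, fun x => by rw [eq_ratCast]; exact hq x⟩
  · intro x y
    apply hinj
    simp only [Rat.cast_add]
    rw [← hq x, ← hq y, ← hq (x + y), map_add]
  · intro r x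
    apply hinj
    simp only [smul_eq_mul, Rat.cast_mul, RingHom.id_apply]
    rw [← hq x, ← hq (r • x), map_smul, Rat.smul_def]

open Classical in
/-- (B2) the trace-dual pairs separate the embeddings: `∑_k σ(y_k) τ(x_k) = [σ = τ]` for a ℚ-basis `x` of `K`
and its trace-dual basis `y`. -/
theorem sum_dualBasis_mul_eq {ι : Type} [Fintype ι] [DecidableEq ι] (b : Module.Basis ι ℚ K)
    (σ τ : K →+* ℂ) :
    ∑ k, σ ((traceForm ℚ K).dualBasis (traceForm_nondegenerate ℚ K) b k) * τ (b k) =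
      if σ = τ then 1 else 0 := by
  set b' := (traceForm ℚ K).dualBasis (traceForm_nondegenerate ℚ K) b with hb'
  -- expansion in the dual basis: `z = ∑ k, Tr(z x_k) • y_k`
  have hexp : ∀ z : K, z = ∑ k, algebraMap ℚ K (Algebra.trace ℚ K (z * b k)) * b' k := by
    intro z
    conv_lhs => rw [← b'.sum_repr z]
    refine Finset.sum_congr rfl fun k _ => ?_
    rw [hb', LinearMap.BilinForm.dualBasis_repr_apply, traceForm_apply, Algebra.smul_def]
  -- apply `σ` and expand the traces over the embeddings
  have h1 : ∀ z : K, σ z = ∑ τ' : K →+* ℂ, (∑ k, σ (b' k) * τ' (b k)) * τ' z := by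
    intro z
    conv_lhs => rw [hexp z]
    rw [map_sum]
    simp only [map_mul, eq_ratCast, map_ratCast, trace_eq_sum_ringHom, Finset.sum_mul]
    rw [Finset.sum_comm]
    refine Finset.sum_congr rfl fun τ' _ => Finset.sum_congr rfl fun k _ => ?_
    ring
  have h2 : ∀ z : K, ∑ τ' : K →+* ℂ, (if σ = τ' then (1 : ℂ) else 0) * τ' z = σ z := by
    intro z
    simp [Finset.sum_ite_eq]
  have key : ∀ z : K, ∑ τ' : K →+* ℂ,
      ((∑ k, σ (b' k) * τ' (b k)) - if σ = τ' then 1 else 0) * τ' z = 0 := by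
    intro z
    simp_rw [sub_mul, Finset.sum_sub_distrib]
    rw [← h1 z, h2 z, sub_self]
  have := eq_zero_of_sum_embeddings _ key τ
  exact sub_eq_zero.1 this

end Summit.Ventures.HodgeRepro2.Tier7.Line2.GaloisTrace
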